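/-
Copyright: lit-balaban Phase-2 proof seat p34 (gen 19).  Statement-level skeleton of a published paper; no proof claims beyond what the
kernel checks below.
-/
import Literature.MathematicalPhysics.QuantumFieldTheory.BalabanImbrieJaffe1984to88.BIJ88NeumannPropagatorSmallFieldRegionDeriv
import Literature.MathematicalPhysics.QuantumFieldTheory.BalabanImbrieJaffe1984to88.BIJ85Claim73AllCouplings

/-!
# [BalabanImbrieJaffe1985] §7.3 p. 326 — **«The propagators arising from Δ_k(u_k), under the restriction (7.3.1) on the gauge field, also
# satisfy the regularity and decay estimates of [7]» FOR THE REGION NEUMANN PROPAGATORS OF RECORD `G_k(Ω,u_k)` AT THE ACTUAL BACKGROUND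
# `u_k = u_k(e_k, v)` OF (4.5.4), HYPOTHESIS-FREE**: the [Balaban1983RegularityDecay] (1.10) VALUE and COVARIANT-DERIVATIVE members, in
# `k`-uniform operator form and in kernel form, for p31's `gBox (α_kL^{kD}) ε⁻¹ u_k k Ω` on EVERY union `Ω` of `k`-blocks of the fine torus, under
# the PRINTED unit-lattice hypothesis (7.3.1) `|v(∂p) − 1| ≤ e_k𝓅(e_k)` on the unit field `v`, with ONE threshold `e_k𝓅(e_k) ≤ c₁(d, L)` for all
# tori, all scales and all regions — front (δ) «smallness of the actual backgrounds» of the C2 §2 closure (owner r18).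

T. Bałaban, J. Imbrie, A. Jaffe, *Renormalization of the Higgs model: minimizers, propagators and the stability of mean field theory*, Commun.
Math. Phys. **97** (1985) 299–329 [BalabanImbrieJaffe1985] = [I], §7.3 p. 326 [PDF 28], (4.5.4) p. 313 [PDF 15]; T. Bałaban, J. Imbrie,
A. Jaffe, *Effective action and cluster properties of the abelian Higgs model*, Commun. Math. Phys. **114** (1988) 257–315
[BalabanImbrieJaffe1988], Sect. 2 p. 263 [PDF 7], (2.27)/(2.30); [7] = [6] = T. Bałaban, *Regularity and decay of lattice Green's functions*,
Commun. Math. Phys. **89** (1983) 571–597 [Balaban1983RegularityDecay], Theorem p. 573, (1.10).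

statement-level skeleton of published theorems with citation tags; proofs where landed; nothing here is a claim about the Yang–Mills mass gap

PDF held: `paper:balaban1985-cmp97-bij-higgs-minimizers` (journal page = PDF page + 298), p. 326 [PDF 28], p. 313 [PDF 15];
`paper:balaban1988-cmp114-bij-abelian-higgs-effective-action` (journal page = PDF page + 256), p. 263 [PDF 7];
`paper:balaban1983-cmp89-regularity-decay` (journal page = PDF page + 570), p. 573 [PDF 3].

CITATION HEADER (lean-in-tree rule).  Part of the lit-balaban TYPED SKELETON (HOME `run/shared/lean/pub/lit-balaban/`), PHASE-2 proof seat
p34 gen 19 (unit `lit-balaban-p34-g19`; TAKING line HOME/STATUS.md 2026-08-23T08:17:29Z; free-target protocol G.5-34(d) — source: the C2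
owner's `HOME/lit-balaban-r18/C2S14-CLOSURE.md` v1.16u–x «REMAINING NON-FLAT FRONT … (δ) smallness of the actual backgrounds (p33/p34)» and
the C1 owner's G-C1-05 ruling 2026-08-22T08:34:47Z «WHAT REMAINS = … the TORUS-vs-REGION / contour-convention relation» of p33's
`BIJ85RegionPropagatorsActualBgThm` HONEST SCOPE (i)).  WHAT IS REPRODUCED: a located MEMBER of rows **C1.Eq7.3.1-7.3.2** (owner r15; [I] p. 326)
and **C2.Eq2.30** / **C2.Claim@263** (owner r18): the small-plaquette hypothesis of the tree's region-propagator theorems at non-flat fields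
(p34 gens 16–18, p27, p30, p31, p29) is DISCHARGED at the backgrounds of record `u_k(e_k, v)` from the printed (7.3.1) on `v`, and the (1.10)
members of p34's lane are stated at `u_k`.  No row is restated and no head changes.
USED BY NAME: p33's `BIJ85Claim73AllTori.exists_KR_allTori` (ONE residual constant `K_R` for all tori, hypothesis-free — [6I] Prop. 1.2 inside,
p19's `prop12Printed_allTori`), `BIJ85Claim73Closed.theta_of_hyp731_closed` ((7.3.1) ⇒ `‖u_k(∂p) − 1‖ ≤ e_kη²K_R(π/2)𝓅(e_k)` at a closed-field
index), `BIJ85Claim73AllCouplings.AllIdx.toClosedIdx` (the index of an arbitrary actual datum), `BIJ85LineSumReflectionD.isClosedPlaq_iff_dPlaq`,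
`BIJ85Eq454PlaqResidual.actualBgU1` / `pow_mul_eta_sq`, r15/p11's `BIJ85AbelianStokes.plaqC` / `plaqC_eq_toC_plaqHol`; p34's
`decay110_smallPlaquette_region_uniform` (gen 18, `BIJ88NeumannPropagatorSmallFieldRegionSup` v1.1), `decay110_smallPlaquette_region_deriv_uniform`
(gen 18, `BIJ88NeumannPropagatorSmallFieldRegionDeriv`), `decay_kernel_smallPlaquette_region_uniform` / `decay_covD_kernel_smallPlaquette_region_uniform`
(gen 16 v1.2, `BIJ88NeumannPropagatorSmallPlaquetteRegion`); p31's `gBox`, `IsBlockUnion`.  Kind: theorems only (no definition, no `Prop`-valued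
fact).

THE PRINTED TEXT, verbatim.  [I] p. 326 [PDF 28]: *"In particular, let us assume that for the unit lattice field v, |v(∂p) − 1| ≦ e_k𝓅(e_k),
(7.3.1) where 𝓅(e_k) = (1 + ln e_k^{−1})^𝓅. … The propagators arising from Δ_k(u_k), under the restriction (7.3.1) on the gauge field, also
satisfy the regularity and decay estimates of [7]. In order to remain within the framework of this reference, we remark that by change of gauge
u_k can be transformed in a local region Λ into a configuration of the form exp[ie_kηA], where A is smooth and small."*  [BalabanImbrieJaffe1988]
p. 263 [PDF 7]: *"G_k(u; x₁, x₂) = Σ_α λ_α G_k(□_α, u; x₁, x₂) (2.27) as a convex combination of Neumann propagators. … |(G_{k,loc}(u)f)(x)| ≦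
c e^{−c dist(suppt f, x)}‖f‖_∞, (2.30) … Bounds analogous to (2.30), (2.31) hold for covariant derivatives and Hölder derivatives of G_{k,loc}(u)
of order less than two."*  [7] p. 573 [PDF 3]: *"|(G_k(Ω, A)f)(x)|, |(D^η_{A,μ}G_k(Ω, A)f)(x)| ≦ c₀ exp(−δ₀ dist(x, supp f))‖f‖_∞ (1.10) for
x ∈ Ω, dist(x, Ω^c) ≧ R₀."*

THE ARGUMENT (the printed one-sentence passage, as a composition of two facts of the tree).  (1) **(7.3.1) ⇒ fine-plaquette smallness of
`u_k`, uniformly** (§1): by [I] (5.2.12) the η-plaquette variables of the actual background are `u_k(∂p) = exp(ie_kη²f_k(p))` with `f_k` the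
residual field (4.2.6); under (7.3.1) with `e_k𝓅(e_k) ≤ ½` the unit plaquette field `f^{(k)} = (ie_k)⁻¹ln v(∂·)` is closed and bounded by
`(π/2)𝓅(e_k)`, so the regularity of Sect. 7.2 — ONE residual constant `K_R(d, L)` over all tori and scales (p33's `exists_KR_allTori`, [6I]
Prop. 1.2 inside) — gives `|f_k| ≤ K_R(π/2)𝓅(e_k)` and hence `‖u_k(∂p) − 1‖ ≤ K·e_k𝓅(e_k)/(L^k)²` at EVERY fine plaquette, `K = (π/2)K_R`
(p33's `theta_of_hyp731_closed` at the index `AllIdx.toClosedIdx` of the datum).  (2) **threshold** (§2): if `K·e_k𝓅(e_k) ≤ 1/(23D²)`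
(`D = d + 1` the dimension) then `θ = K·e_k𝓅(e_k)/(L^k)²` meets every side condition of the tree's `k`-uniform small-plaquette theorems:
`2D³(L^{2k}θ)² ≤ 1`, `(L^{2k}θ)² ≤ 1/500`, and `2(L^k−1)L^k·D·T² + 2(D(L^k−1)T)² ≤ ½` at `T = (D−1)(L^k−1)θ` (real arithmetic, every `D ≥ 1`).
(3) **members** (§3): p34's `_uniform` theorems at `U := u_k`, `θ := K·e_k𝓅(e_k)/(L^k)²`.

WHAT IS PROVED (0 `sorry`; standard axioms; theorems only).
* §1 **`plaqSmall_actualBg_of_hyp731 (hd : 2 ≤ d) (pexp) : ∃ K ≥ 1, ∀ P, P.d = d → P.L = L → ∀ (hd2) k, 1 ≤ k → k ≤ m+K → ∀ e, 0 < e → e ≤ 1 →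
  e𝓅(e) ≤ ½ → ∀ v, (∀ q, ‖v(∂q) − 1‖ ≤ e𝓅(e)) → (∀ x μ ν, ‖plaqC (actualBgU1 hd2 k e v) x μ ν − 1‖ ≤ K·e𝓅(e)/(L^k)²) ∧
  (∀ p, ‖toC (plaqHol (actualBgU1 hd2 k e v) p) − 1‖ ≤ K·e𝓅(e)/(L^k)²)`** — FRONT (δ): the fine-plaquette smallness hypothesis of EVERY
  small-plaquette theorem of the tree (`plaqC` form: p30/p27/p31; `plaqHol` form: p34/p27/p29) at the actual background, from the printed (7.3.1),
  one `K(d, L)` for all tori and scales.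
* §2 **`threshold_conditions`**: `1 ≤ D`, `1 ≤ n`, `0 ≤ θ`, `n²θ ≤ 1/(23D²)` ⟹ `2D³(n²θ)² ≤ 1`, the `(T, ½)` condition at `T = (D−1)(n−1)θ`, and
  `(n²θ)² ≤ 1/500`; `half_of_threshold` (`e𝓅(e) ≤ 1/(23D²K)` ⟹ `e𝓅(e) ≤ ½`), `tau_le_of_threshold`, `calP_mul_nonneg`, `smallness_pack` (the
  five facts at `θ = K·t/n²`); **`smallPlaquette_actualBg`** — THE PASSAGE PACKAGED: at the actual background under (7.3.1) and the one
  threshold `e𝓅(e) ≤ 1/(23D²K)`, `θ = K·e𝓅(e)/(L^k)²` is `≥ 0`, bounds every fine plaquette of `u_k` (`plaqC` and `plaqHol` forms) and meets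
  `2D³(L^{2k}θ)² ≤ 1`, the members' `T`-slot inequality, the `(T, ½)` condition and `(L^{2k}θ)² ≤ 1/500` — the hypotheses of every
  small-plaquette theorem of the tree, so each member below (and p27/p30/p31's) is its theorem applied to these seven facts.
* §3 at the actual background, ONE threshold `c₁ = 1/(23D²K)`, constants `(δ₀, c₀)` / `(t₀, c₁′)` from `(d, ℓ, a)` only:
  **`decay110_region_actualBg`** — `‖(G_k(Ω,u_k)f)(x)‖ ≤ (L^kε)²·c₀e^{−δ₀D_f/L^k}‖f‖_∞` for EVERY `k`-block union `Ω`, EVERY row `x`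
  (`D = d+1 ≤ 3`, `L = ℓ+1`, `1 ≤ k ≤ m+K`, `2(L^k−1)+4 < |T|`); **`decay110_region_deriv_actualBg`** — `‖(D_{u_k}G_k(Ω,u_k)f)(⟨x,μ⟩)‖ ≤
  c₁′(L^kε)e^{−t₀D_f/L^k}‖f‖_∞` at bonds with `dist_∞(x, T∖Ω) ≥ L^k` (`L` odd, `k ≤ K`); **`decay_kernel_region_actualBg`** /
  **`decay_covD_kernel_region_actualBg`** — `‖G_k(Ω,u_k;x,y)‖ ≤ c₀(L^kε)²e^{−t₀|x−y|_∞/L^k}` and `‖ε⁻¹(u_k(b)G_k(Ω,u_k;b₊,y) − G_k(Ω,u_k;b₋,y))‖ ≤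
  c₁′(L^kε)e^{−t₀|y−b₊|_∞/L^k}` (`b ∈ Ω*`), EVERY dimension `P.d = d ≥ 2`, any `L`.
HONEST SCOPE.  (i) The PRINTED hypothesis (7.3.1) is used on ALL unit plaquettes of `T^{(k)}` (as printed on p. 326: a restriction on the unit
lattice field `v`), and the conclusion is the (1.10) pair for the tree's region propagators in the tree's conventions (centred block averages,
Neumann bonds `Ω*`, p31's `gBox` with `a = α_kL^{kD}`, `c = ε⁻¹`); the relation of `gBox … univ` to [I]'s `G_k(u_k)` of (4.6.2) as p11's `opT`
inverse is not addressed here (p33's `BIJ85Claim73PropagatorDecay` treats that operator directly).  (ii) «for e sufficiently small»: the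
threshold `e_k𝓅(e_k) ≤ 1/(23D²K)`, `K = (π/2)K_R(d, L)` with p33's all-tori residual constant (explicit in the proof of `exists_KR_allTori`, not
evaluated); no other hypothesis.  (iii) The members' own scope notes apply verbatim: operator-form members for `D = d+1 ∈ {2, 3}` and `L = ℓ+1`
(odd for the D_u member, `k ≤ K` there), deep bonds only for D_u (`dist_∞(x, T∖Ω) ≥ L^k`, [7]'s `R₀`); kernel members for every dimension `P.d = d ≥ 2` and every `L`; all
need more than two `k`-blocks per direction (`2(L^k−1)+4 < |T|`, i.e. `k < m+K`); constants existential, from `(d, ℓ, a)`; method divergence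
from [7]'s random-walk expansion as disclosed in the member files.  (iv) No Hölder (1.9) / closeness (1.11)–(1.12) member here (p27/p30 lanes;
§1–§2 are their one-line passage too).  Literature + Mathlib only.  Unit `lit-balaban-p34` (literature-prover-lit-balaban-p34-g19-0),
2026-08-23.  NOT summit progress.
-/

open scoped BigOperators ComplexConjugate
open Finset Matrix

namespace Literature.MathematicalPhysics.QuantumFieldTheory.BalabanImbrieJaffe1984to88.BIJ88NeumannPropagatorActualBackground

open Literature.MathematicalPhysics.QuantumFieldTheory.Balaban1983to89 hiding Site Plaq
open LatticeFieldCalculus (supDist)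
open BIJ88Sect3Statements (U1 toC cfg covD starB)
open BIJ85Sect1Model (U1Field plaq)
open BIJ85AbelianStokes (plaqC plaqC_eq_toC_plaqHol)
open BIJ85Sigma421Torus (toU)
open BIJ85Eq454PlaqResidual (resE actualBgU1 pow_mul_eta_sq)
open BIJ85Claim73Closed (dPlaq ClosedIdx theta_of_hyp731_closed)
open BIJ85Claim73AllTori (exists_KR_allTori)
open BIJ85Claim73AllCouplings (AllIdx)
open BIJ85LineSumReflectionD (isClosedPlaq_iff_dPlaq)
open BIJ88NeumannNoZeroModesTorus (IsBlockUnion)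
open BIJ88NeumannPropagator227Torus (gBox)
open BIJ88NeumannPropagatorSmallPlaquetteRegion (decay_kernel_smallPlaquette_region_uniform decay_covD_kernel_smallPlaquette_region_uniform)
open BIJ88NeumannPropagatorSmallFieldRegionSup (decay110_smallPlaquette_region_uniform)
open BIJ88NeumannPropagatorSmallFieldRegionDeriv (decay110_smallPlaquette_region_deriv_uniform)
open Balaban1983to89 renaming Site → TSite, Plaq → TPlaq

noncomputable section

/-! ## §1 Front (δ): (7.3.1) on the unit field ⇒ fine-plaquette smallness of the actual background `u_k`, one constant for all tori -/

/-- kernel: a bound `|g q| ≤ C` on the unit plaquettes of a torus of dimension `≥ 2` forces `0 ≤ C` (there is a plaquette).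
[cite: BalabanImbrieJaffe1985, (7.3.1) p.326] -/
private theorem nonneg_of_plaqBound {P : Params} (hd : 2 ≤ P.d) {k : ℕ} {g : TPlaq P k → ℝ} {C : ℝ} (hg : ∀ q, |g q| ≤ C) :
    0 ≤ C :=
  (abs_nonneg _).trans (hg ⟨default, ⟨0, by omega⟩, ⟨1, by omega⟩, by simp [Fin.lt_def]⟩)

/-- kernel: `η_k² = ((L^k)²)⁻¹` for the tree's `η_k = L^{−k}`. [cite: BalabanImbrieJaffe1985, (2.1) p.302] -/
theorem eta_sq_eq_inv (P : Params) (k : ℕ) : (P.eta k) ^ 2 = (((P.L : ℝ) ^ k) ^ 2)⁻¹ :=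
  (inv_eq_of_mul_eq_one_right (pow_mul_eta_sq P k)).symm

/-- **FRONT (δ) — THE FINE-PLAQUETTE SMALLNESS OF THE ACTUAL BACKGROUND `u_k(e_k, v)` (4.5.4) UNDER THE PRINTED (7.3.1), ONE CONSTANT FOR ALL
TORI AND SCALES.**  For every dimension `d ≥ 2`, block size `L` and exponent `𝓅` there is `K ≥ 1` (namely `(π/2)K_R(d, L)`, p33's all-tori
residual constant) such that for EVERY torus `P` with `P.d = d`, `P.L = L`, every scale `1 ≤ k ≤ m + K`, every coupling `0 < e ≤ 1` with
`e𝓅(e) ≤ ½` and every unit-lattice `U(1)` field `v` with `‖v(∂q) − 1‖ ≤ e𝓅(e)` for all unit plaquettes `q` (7.3.1): EVERY fine (η-lattice)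
plaquette variable of `u_k = actualBgU1 hd2 k e v` is within `K·e𝓅(e)/(L^k)²` of `1` — in the all-orientation form `plaqC` (p30/p27/p31's
hypothesis) and in the tree's `plaqHol` form (p34/p27/p29's hypothesis).  p33's `theta_of_hyp731_closed` at the closed-field index
`AllIdx.toClosedIdx` of the datum fed with `exists_KR_allTori` (at the auxiliary mass parameter `a = 1`), `η_k² = (L^k)^{−2}`.
[cite: BalabanImbrieJaffe1985, (7.3.1) p.326, (5.2.12) p.317, (4.5.4) p.313] -/
theorem plaqSmall_actualBg_of_hyp731 {d L : ℕ} (hd : 2 ≤ d) (pexp : ℝ) :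
    ∃ K : ℝ, 1 ≤ K ∧ ∀ (P : Params) (hPd : P.d = d) (hPL : P.L = L) (hd2 : 2 ≤ P.d) (k : ℕ), 1 ≤ k → k ≤ P.m + P.K →
      ∀ (e : ℝ), 0 < e → e ≤ 1 → e * (1 + Real.log e⁻¹) ^ pexp ≤ 1 / 2 →
      ∀ (v : U1Field P k), (∀ q : TPlaq P k, ‖((plaq v q : Circle) : ℂ) - 1‖ ≤ e * (1 + Real.log e⁻¹) ^ pexp) →
        (∀ (x : TSite P 0) (μ ν : Fin P.d),
          ‖plaqC (actualBgU1 hd2 k e v) x μ ν - 1‖ ≤ K * (e * (1 + Real.log e⁻¹) ^ pexp) / ((P.L : ℝ) ^ k) ^ 2) ∧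
        (∀ p : TPlaq P 0,
          ‖toC (GaugeField.plaqHol (actualBgU1 hd2 k e v) p) - 1‖ ≤ K * (e * (1 + Real.log e⁻¹) ^ pexp) / ((P.L : ℝ) ^ k) ^ 2) := by
  obtain ⟨KR, hKR1, hKR⟩ := exists_KR_allTori (d := d) (L := L) hd (a := 1) one_pos
  have hpi : (1 : ℝ) ≤ Real.pi / 2 := by linarith [Real.pi_gt_three]
  refine ⟨KR * (Real.pi / 2), one_le_mul_of_one_le_of_one_le hKR1 hpi, ?_⟩
  intro P hPd hPL hd2 k hk1 hk e he he1 hsmall v hv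
  -- the datum as an index of p33's family, and its closed-field index at the all-tori `K_R`
  set i : AllIdx d L := ⟨P, hPd, hPL, hd2, k, hk1, hk, e, he, he1, v⟩ with hi
  have hR : ∀ (g : TPlaq i.P i.k → ℝ),
      (∀ (x : TSite i.P i.k) (μ ν lam : Fin i.P.d) (hμν : μ < ν) (hνl : ν < lam), dPlaq g x hμν hνl = 0) →
      ∀ (C : ℝ), (∀ q, |g q| ≤ C) →
        ∀ p : TPlaq i.P 0, |resE i.hd2 ((i.P.eta i.k) ^ i.P.d) (i.P.eta i.k)⁻¹ i.k (toU i.P i.k g) p| ≤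
          KR * Real.sqrt ((i.P.eta i.k) ^ i.P.d) * C :=
    fun g hg C hC p => hKR i.P i.hd i.hL i.k i.hk1 i.hk g ((isClosedPlaq_iff_dPlaq g).2 hg) C (nonneg_of_plaqBound i.hd2 hC) hC p
  have hθ := theta_of_hyp731_closed 1 one_pos (i.toClosedIdx hsmall hR) hv
  -- `e·η_k²·(K_R·((π/2)·𝓅)) = (K_R·π/2)·e𝓅 / (L^k)²`
  have hconv : e * (P.eta k) ^ 2 * (KR * (Real.pi / 2 * (1 + Real.log e⁻¹) ^ pexp))
      = KR * (Real.pi / 2) * (e * (1 + Real.log e⁻¹) ^ pexp) / ((P.L : ℝ) ^ k) ^ 2 := by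
    rw [eta_sq_eq_inv P k]; ring
  have hC : ∀ (x : TSite P 0) (μ ν : Fin P.d),
      ‖plaqC (actualBgU1 hd2 k e v) x μ ν - 1‖ ≤ KR * (Real.pi / 2) * (e * (1 + Real.log e⁻¹) ^ pexp) / ((P.L : ℝ) ^ k) ^ 2 :=
    fun x μ ν => (hθ x μ ν).trans (le_of_eq hconv)
  refine ⟨hC, ?_⟩
  rintro ⟨x, μ, ν, hμν⟩
  rw [← plaqC_eq_toC_plaqHol _ x hμν]
  exact hC x μ ν

/-! ## §2 The threshold: `L^{2k}θ ≤ 1/(23D²)` meets every side condition of the `k`-uniform small-plaquette theorems -/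

/-- kernel (real arithmetic, every dimension): for `D ≥ 1`, `n ≥ 1`, `θ ≥ 0` with `n²θ ≤ 1/(23D²)`: (a) `2D³(n²θ)² ≤ 1` (p27/p30's block-scale
condition), (b) `2((n−1)n)·D·T² + 2(D(n−1)T)² ≤ ½` at `T = (D−1)(n−1)θ` (p34's `(T, ½)` condition of the blockwise centred gauge), (c)
`(n²θ)² ≤ 1/500` (p31/p30's threshold) — since `(n²θ)²D⁴ ≤ 1/529`. [cite: BalabanImbrieJaffe1985, (7.3.1) p.326] -/
theorem threshold_conditions {dr n θ : ℝ} (hd1 : 1 ≤ dr) (hn : 1 ≤ n) (hθ : 0 ≤ θ) (hτ : n ^ 2 * θ ≤ 1 / (23 * dr ^ 2)) :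
    2 * dr ^ 3 * (n ^ 2 * θ) ^ 2 ≤ 1 ∧
      2 * ((n - 1) * n) * dr * ((dr - 1) * (n - 1) * θ) ^ 2 + 2 * (dr * (n - 1) * ((dr - 1) * (n - 1) * θ)) ^ 2 ≤ 1 / 2 ∧
      (n ^ 2 * θ) ^ 2 ≤ 1 / 500 := by
  have hd0 : 0 ≤ dr := by linarith
  have hn0 : 0 ≤ n := by linarith
  have hτ0 : 0 ≤ n ^ 2 * θ := by positivity
  have hd2 : 0 < dr ^ 2 := by positivity
  have hd4 : 1 ≤ dr ^ 4 := one_le_pow₀ hd1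
  have h1 : n ^ 2 * θ * dr ^ 2 ≤ 1 / 23 := by
    have h := (le_div_iff₀ (by positivity : (0 : ℝ) < 23 * dr ^ 2)).1 hτ
    linarith
  have key : (n ^ 2 * θ) ^ 2 * dr ^ 4 ≤ 1 / 529 := by
    have h2 : 0 ≤ n ^ 2 * θ * dr ^ 2 := by positivity
    calc (n ^ 2 * θ) ^ 2 * dr ^ 4 = (n ^ 2 * θ * dr ^ 2) ^ 2 := by ring
      _ ≤ (1 / 23) ^ 2 := pow_le_pow_left₀ h2 h1 2
      _ = 1 / 529 := by norm_num
  have hsq0 : 0 ≤ (n ^ 2 * θ) ^ 2 := sq_nonneg _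
  have h34 : dr ^ 3 ≤ dr ^ 4 := pow_le_pow_right₀ hd1 (by norm_num)
  refine ⟨?_, ?_, ?_⟩
  · calc 2 * dr ^ 3 * (n ^ 2 * θ) ^ 2 ≤ 2 * dr ^ 4 * (n ^ 2 * θ) ^ 2 := by gcongr
      _ = 2 * ((n ^ 2 * θ) ^ 2 * dr ^ 4) := by ring
      _ ≤ 2 * (1 / 529) := by gcongr
      _ ≤ 1 := by norm_num
  · have hn1 : n - 1 ≤ n := by linarith
    have hdr1 : dr - 1 ≤ dr := by linarith
    have hn10 : 0 ≤ n - 1 := by linarith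
    have hdr10 : 0 ≤ dr - 1 := by linarith
    calc 2 * ((n - 1) * n) * dr * ((dr - 1) * (n - 1) * θ) ^ 2 + 2 * (dr * (n - 1) * ((dr - 1) * (n - 1) * θ)) ^ 2
        ≤ 2 * (n * n) * dr * (dr * n * θ) ^ 2 + 2 * (dr * n * (dr * n * θ)) ^ 2 := by gcongr
      _ = (2 * dr ^ 3 + 2 * dr ^ 4) * (n ^ 2 * θ) ^ 2 := by ring
      _ ≤ (2 * dr ^ 4 + 2 * dr ^ 4) * (n ^ 2 * θ) ^ 2 := by gcongr
      _ = 4 * ((n ^ 2 * θ) ^ 2 * dr ^ 4) := by ring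
      _ ≤ 4 * (1 / 529) := by gcongr
      _ ≤ 1 / 2 := by norm_num
  · calc (n ^ 2 * θ) ^ 2 ≤ (n ^ 2 * θ) ^ 2 * dr ^ 4 := le_mul_of_one_le_right hsq0 hd4
      _ ≤ 1 / 529 := key
      _ ≤ 1 / 500 := by norm_num

/-- kernel: the threshold implies the small-field regime `e𝓅(e) ≤ ½` of §1 (`K ≥ 1`, `D ≥ 1`: `1/(23D²K) ≤ 1/23 ≤ ½`).
[cite: BalabanImbrieJaffe1985, (7.3.1) p.326] -/
theorem half_of_threshold {K D t : ℝ} (hK : 1 ≤ K) (hD : 1 ≤ D) (ht : t ≤ 1 / (23 * D ^ 2 * K)) : t ≤ 1 / 2 := by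
  have hD2 : 1 ≤ D ^ 2 := one_le_pow₀ hD
  have h23 : (23 : ℝ) ≤ 23 * D ^ 2 * K := by nlinarith
  have h : 1 / (23 * D ^ 2 * K) ≤ 1 / 23 := one_div_le_one_div_of_le (by norm_num) h23
  linarith

/-- kernel: under the threshold, `τ = K·t ≤ 1/(23D²)` (`K > 0`). [cite: BalabanImbrieJaffe1985, (7.3.1) p.326] -/
theorem tau_le_of_threshold {K D t : ℝ} (hK : 0 < K) (ht : t ≤ 1 / (23 * D ^ 2 * K)) : K * t ≤ 1 / (23 * D ^ 2) := by
  have h := mul_le_mul_of_nonneg_left ht hK.le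
  refine h.trans (le_of_eq ?_)
  by_cases hD : D = 0
  · subst hD; simp
  · field_simp

/-- kernel: `0 ≤ e𝓅(e)` for `0 < e ≤ 1` (`𝓅(e) = (1 + ln e⁻¹)^𝓅` with a nonnegative base). [cite: BalabanImbrieJaffe1985, (7.3.1) p.326] -/
theorem calP_mul_nonneg {e : ℝ} (he : 0 < e) (he1 : e ≤ 1) (pexp : ℝ) : 0 ≤ e * (1 + Real.log e⁻¹) ^ pexp := by
  have hb : 0 ≤ 1 + Real.log e⁻¹ := by
    have := Real.log_nonneg ((one_le_inv₀ he).2 he1); linarith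
  exact mul_nonneg he.le (Real.rpow_nonneg hb _)

/-- kernel: THE SMALLNESS PACKAGE — for `K ≥ 1`, `D ≥ 1`, `n ≥ 1`, `0 ≤ t ≤ 1/(23D²K)` and `θ = K·t/n²`: `t ≤ ½`, `0 ≤ θ`, and the three
conditions of `threshold_conditions` at `θ` (`n²θ = K·t`). [cite: BalabanImbrieJaffe1985, (7.3.1) p.326] -/
theorem smallness_pack {K D n t : ℝ} (hK : 1 ≤ K) (hD : 1 ≤ D) (hn : 1 ≤ n) (ht : 0 ≤ t) (hsm : t ≤ 1 / (23 * D ^ 2 * K)) :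
    t ≤ 1 / 2 ∧ 0 ≤ K * t / n ^ 2 ∧ 2 * D ^ 3 * (n ^ 2 * (K * t / n ^ 2)) ^ 2 ≤ 1 ∧
      2 * ((n - 1) * n) * D * ((D - 1) * (n - 1) * (K * t / n ^ 2)) ^ 2 +
          2 * (D * (n - 1) * ((D - 1) * (n - 1) * (K * t / n ^ 2))) ^ 2 ≤ 1 / 2 ∧
      (n ^ 2 * (K * t / n ^ 2)) ^ 2 ≤ 1 / 500 := by
  have hK0 : 0 < K := by linarith
  have hn2 : (0 : ℝ) < n ^ 2 := by positivity
  have hθ0 : 0 ≤ K * t / n ^ 2 := div_nonneg (mul_nonneg hK0.le ht) hn2.le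
  have hnθ : n ^ 2 * (K * t / n ^ 2) = K * t := mul_div_cancel₀ _ hn2.ne'
  have hτ : n ^ 2 * (K * t / n ^ 2) ≤ 1 / (23 * D ^ 2) := by rw [hnθ]; exact tau_le_of_threshold hK0 hsm
  exact ⟨half_of_threshold hK hD hsm, hθ0, threshold_conditions hD hn hθ0 hτ⟩

/-- **THE PASSAGE, PACKAGED — everything a small-plaquette theorem of the tree asks of its field, AT THE ACTUAL BACKGROUND under the printed
(7.3.1) and ONE threshold.**  For `d ≥ 2`, `L`, `𝓅` there is `K ≥ 1` (§1's) such that for every torus (`P.d = d`, `P.L = L`), `1 ≤ k ≤ m + K`,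
`0 < e ≤ 1` with `e𝓅(e) ≤ 1/(23D²K)` (`D = P.d`) and every `v` with (7.3.1), the number `θ = K·e𝓅(e)/(L^k)²` satisfies: `0 ≤ θ`; every fine
plaquette of `u_k` is within `θ` of `1` (`plaqC` and `plaqHol` forms); `2D³(L^{2k}θ)² ≤ 1`; `((D−1 : ℕ) : ℝ)(L^k−1)θ ≤ (D−1)(L^k−1)θ` (the
members' `T`-slot) and the `(T, ½)` condition at `T = (D−1)(L^k−1)θ`; `(L^{2k}θ)² ≤ 1/500`. [cite: BalabanImbrieJaffe1985, (7.3.1) p.326, (4.5.4) p.313] -/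
theorem smallPlaquette_actualBg {d L : ℕ} (hd : 2 ≤ d) (pexp : ℝ) :
    ∃ K : ℝ, 1 ≤ K ∧ ∀ (P : Params) (hPd : P.d = d) (hPL : P.L = L) (hd2 : 2 ≤ P.d) (k : ℕ), 1 ≤ k → k ≤ P.m + P.K →
      ∀ (e : ℝ), 0 < e → e ≤ 1 → e * (1 + Real.log e⁻¹) ^ pexp ≤ 1 / (23 * (P.d : ℝ) ^ 2 * K) →
      ∀ (v : U1Field P k), (∀ q : TPlaq P k, ‖((plaq v q : Circle) : ℂ) - 1‖ ≤ e * (1 + Real.log e⁻¹) ^ pexp) →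
        0 ≤ K * (e * (1 + Real.log e⁻¹) ^ pexp) / ((P.L : ℝ) ^ k) ^ 2 ∧
        (∀ (x : TSite P 0) (μ ν : Fin P.d),
          ‖plaqC (actualBgU1 hd2 k e v) x μ ν - 1‖ ≤ K * (e * (1 + Real.log e⁻¹) ^ pexp) / ((P.L : ℝ) ^ k) ^ 2) ∧
        (∀ p : TPlaq P 0,
          ‖toC (GaugeField.plaqHol (actualBgU1 hd2 k e v) p) - 1‖ ≤ K * (e * (1 + Real.log e⁻¹) ^ pexp) / ((P.L : ℝ) ^ k) ^ 2) ∧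
        2 * (P.d : ℝ) ^ 3 * (((P.L : ℝ) ^ k) ^ 2 * (K * (e * (1 + Real.log e⁻¹) ^ pexp) / ((P.L : ℝ) ^ k) ^ 2)) ^ 2 ≤ 1 ∧
        ((P.d - 1 : ℕ) : ℝ) * ((P.L : ℝ) ^ k - 1) * (K * (e * (1 + Real.log e⁻¹) ^ pexp) / ((P.L : ℝ) ^ k) ^ 2)
          ≤ ((P.d : ℝ) - 1) * ((P.L : ℝ) ^ k - 1) * (K * (e * (1 + Real.log e⁻¹) ^ pexp) / ((P.L : ℝ) ^ k) ^ 2) ∧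
        2 * (((P.L : ℝ) ^ k - 1) * (P.L : ℝ) ^ k) * P.d
              * (((P.d : ℝ) - 1) * ((P.L : ℝ) ^ k - 1) * (K * (e * (1 + Real.log e⁻¹) ^ pexp) / ((P.L : ℝ) ^ k) ^ 2)) ^ 2 +
            2 * (P.d * ((P.L : ℝ) ^ k - 1)
              * (((P.d : ℝ) - 1) * ((P.L : ℝ) ^ k - 1) * (K * (e * (1 + Real.log e⁻¹) ^ pexp) / ((P.L : ℝ) ^ k) ^ 2))) ^ 2 ≤ 1 / 2 ∧
        (((P.L : ℝ) ^ k) ^ 2 * (K * (e * (1 + Real.log e⁻¹) ^ pexp) / ((P.L : ℝ) ^ k) ^ 2)) ^ 2 ≤ 1 / 500 := by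
  obtain ⟨K, hK1, HK⟩ := plaqSmall_actualBg_of_hyp731 (d := d) (L := L) hd pexp
  refine ⟨K, hK1, ?_⟩
  intro P hPd hPL hd2 k hk1 hk e he he1 hsm v hv
  have hd1r : (1 : ℝ) ≤ P.d := by exact_mod_cast P.hd
  have hLr : (1 : ℝ) ≤ (P.L : ℝ) ^ k := one_le_pow₀ (B1RG242Torus.one_lt_cast_L P).le
  obtain ⟨hhalf, hθ0, h1, h2, h3⟩ := smallness_pack (n := (P.L : ℝ) ^ k) hK1 hd1r hLr (calP_mul_nonneg he he1 pexp) hsm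
  obtain ⟨hC, hH⟩ := HK P hPd hPL hd2 k hk1 hk e he he1 hhalf v hv
  refine ⟨hθ0, hC, hH, h1, le_of_eq ?_, h2, h3⟩
  rw [mul_assoc, Nat.cast_sub P.hd, Nat.cast_one, ← mul_assoc]

/-! ## §3 The (1.10) members for the region propagators at the actual background -/

section Members

/-- **[7] (1.10), VALUE MEMBER, `k`-UNIFORM OPERATOR FORM, FOR `G_k(Ω,u_k)` ON EVERY `k`-BLOCK UNION AT THE ACTUAL BACKGROUND UNDER THE PRINTED
(7.3.1).**  For `D = d + 1 ∈ {2, 3}`, `L = ℓ + 1 ≥ 2`, `a > 0`, exponent `𝓅`: there are `c₁ > 0` (`= 1/(23D²K(D, L))`) and `δ₀, c₀ > 0` (from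
`(d, ℓ, a)` only) such that for EVERY torus `P` (`P.d = D`, `P.L = L`), every `1 ≤ k ≤ m + K` with `2(L^k − 1) + 4 < |T|`, every coupling
`0 < e ≤ 1` with `e𝓅(e) ≤ c₁`, every unit field `v` with (7.3.1) `‖v(∂q) − 1‖ ≤ e𝓅(e)` for all `q`, EVERY union `Ω` of `k`-blocks, every row `x`
and every `f` with `‖f‖ ≤ F` supported at sup-distance `≥ D_f` from `x`:
`‖(G_k(Ω,u_k)f)(x)‖ ≤ (L^kε)²·c₀e^{−δ₀D_f/L^k}·F`, `G_k(Ω,u_k) = gBox (α_kL^{kD}) ε⁻¹ (actualBgU1 hd2 k e v) k Ω` — p34 gen 18's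
`decay110_smallPlaquette_region_uniform` at `θ = K·e𝓅(e)/(L^k)²` (§1) under §2.
[cite: BalabanImbrieJaffe1985, (7.3.1) p.326 «also satisfy the regularity and decay estimates of [7]»]
[cite: Balaban1983RegularityDecay, Theorem p.573 (1.10)] [cite: BalabanImbrieJaffe1988, (2.30) p.263] -/
theorem decay110_region_actualBg (d ℓ : ℕ) (hd1 : 1 ≤ d) (hd3 : d + 1 ≤ 3) (hℓ : 1 ≤ ℓ) {a : ℝ} (ha : 0 < a) (pexp : ℝ) :
    ∃ c₁ δ₀ c₀ : ℝ, 0 < c₁ ∧ 0 < δ₀ ∧ 0 < c₀ ∧ ∀ (P : Params) (hPd : P.d = d + 1), P.L = ℓ + 1 →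
      ∀ (hd2 : 2 ≤ P.d) (k : ℕ), 1 ≤ k → k ≤ P.m + P.K → 2 * (P.L ^ k - 1) + 4 < P.sitesPerDir 0 →
      ∀ (e : ℝ), 0 < e → e ≤ 1 → e * (1 + Real.log e⁻¹) ^ pexp ≤ c₁ →
      ∀ (v : U1Field P k), (∀ q : TPlaq P k, ‖((plaq v q : Circle) : ℂ) - 1‖ ≤ e * (1 + Real.log e⁻¹) ^ pexp) →
        ∀ Ω : Finset (TSite P 0), IsBlockUnion k Ω →
          ∀ (x : TSite P 0) (f : TSite P 0 → ℂ) (F D : ℝ), (∀ y, ‖f y‖ ≤ F) →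
            (∀ y, f y ≠ 0 → D ≤ B5Ineq137Torus.T P 0 x y) →
            ‖(gBox (B1RG242Torus.α P a k * (P.L : ℝ) ^ (k * P.d)) P.eps⁻¹ (actualBgU1 hd2 k e v) k Ω *ᵥ f) x‖
              ≤ P.spacing k ^ 2 * (c₀ * Real.exp (-(δ₀ * (((P.L : ℝ) ^ k)⁻¹ * D))) * F) := by
  obtain ⟨K, hK1, HK⟩ := smallPlaquette_actualBg (d := d + 1) (L := ℓ + 1) (by omega) pexp
  obtain ⟨δ₀, c₀, hδ₀, hc₀, H⟩ := decay110_smallPlaquette_region_uniform d ℓ hd3 hℓ ha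
  refine ⟨1 / (23 * ((d : ℝ) + 1) ^ 2 * K), δ₀, c₀, by positivity, hδ₀, hc₀, ?_⟩
  intro P hPd hPL hd2 k hk1 hk hbig e he he1 hsm v hv Ω hΩ x f F D hF hsupp
  have hdr : (P.d : ℝ) = (d : ℝ) + 1 := by rw [hPd]; push_cast; ring
  rw [← hdr] at hsm
  obtain ⟨hθ0, -, hplaq, -, hT, h2, -⟩ := HK P hPd hPL hd2 k hk1 hk e he he1 hsm v hv
  exact H P hPd hPL k hk1 hk hbig (actualBgU1 hd2 k e v) _ hθ0 hplaq _ hT h2 Ω hΩ x f F D hF hsupp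

/-- **[7] (1.10), COVARIANT-DERIVATIVE MEMBER, `k`-UNIFORM OPERATOR FORM, FOR `G_k(Ω,u_k)` ON EVERY `k`-BLOCK UNION AT THE ACTUAL BACKGROUND
UNDER THE PRINTED (7.3.1), DEEP BONDS.**  For `D = d + 1 ∈ {2, 3}`, `L` odd `> 1`, `a > 0`, `𝓅`: there are `c₁ > 0` (`= 1/(23D²K(D, L))`) and
`t₀, c₁′ > 0` (from `(d, L, a)` only) such that for EVERY torus `P` (`P.d = D`, `P.L = L`), every `1 ≤ k ≤ K` with `2(L^k − 1) + 4 < |T|`, every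
`0 < e ≤ 1` with `e𝓅(e) ≤ c₁`, every unit field `v` with (7.3.1), EVERY union `Ω` of `k`-blocks, every bond `⟨x, x+e_μ⟩` with
`dist_∞(x, T∖Ω) ≥ L^k` and every `f` with `‖f‖ ≤ F` supported at sup-distance `≥ D_f` from `x`:
`‖(D_{u_k}G_k(Ω,u_k)f)(⟨x,μ⟩)‖ ≤ c₁′·(L^kε)·e^{−t₀D_f/L^k}·F` — p34 gen 18's `decay110_smallPlaquette_region_deriv_uniform` at
`θ = K·e𝓅(e)/(L^k)²` (§1) under §2 (both of its numeric conditions).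
[cite: BalabanImbrieJaffe1985, (7.3.1) p.326 «also satisfy the regularity and decay estimates of [7]»]
[cite: Balaban1983RegularityDecay, Theorem p.573 (1.10)] [cite: BalabanImbrieJaffe1988, p.263 «Bounds analogous to (2.30), (2.31) hold for covariant derivatives»] -/
theorem decay110_region_deriv_actualBg (d L : ℕ) (hd1 : 1 ≤ d) (hd3 : d + 1 ≤ 3) (hL : Odd L ∧ 1 < L) {a : ℝ} (ha : 0 < a) (pexp : ℝ) :
    ∃ c₁ t₀ c₁' : ℝ, 0 < c₁ ∧ 0 < t₀ ∧ 0 < c₁' ∧ ∀ (P : Params) (hPd : P.d = d + 1), P.L = L →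
      ∀ (hd2 : 2 ≤ P.d) (k : ℕ), 1 ≤ k → k ≤ P.K → 2 * (P.L ^ k - 1) + 4 < P.sitesPerDir 0 →
      ∀ (e : ℝ), 0 < e → e ≤ 1 → e * (1 + Real.log e⁻¹) ^ pexp ≤ c₁ →
      ∀ (v : U1Field P k), (∀ q : TPlaq P k, ‖((plaq v q : Circle) : ℂ) - 1‖ ≤ e * (1 + Real.log e⁻¹) ^ pexp) →
        ∀ Ω : Finset (TSite P 0), IsBlockUnion k Ω →
          ∀ (x : TSite P 0) (μ : Fin P.d) (f : TSite P 0 → ℂ) (F D : ℝ),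
            (∀ z, ‖f z‖ ≤ F) → (∀ z, f z ≠ 0 → D ≤ (supDist x z : ℝ)) →
            (∀ w, w ∉ Ω → P.L ^ k ≤ supDist x w) →
            ‖covD P.eps⁻¹ (cfg (actualBgU1 hd2 k e v))
                (gBox (B1RG242Torus.α P a k * (P.L : ℝ) ^ (k * P.d)) P.eps⁻¹ (actualBgU1 hd2 k e v) k Ω *ᵥ f) ⟨x, μ⟩‖
              ≤ c₁' * P.spacing k * Real.exp (-(t₀ * D / (P.L : ℝ) ^ k)) * F := by
  obtain ⟨K, hK1, HK⟩ := smallPlaquette_actualBg (d := d + 1) (L := L) (by omega) pexp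
  obtain ⟨t₀, c₁', ht₀, hc₁', H⟩ := decay110_smallPlaquette_region_deriv_uniform d L hd1 hd3 hL ha
  refine ⟨1 / (23 * ((d : ℝ) + 1) ^ 2 * K), t₀, c₁', by positivity, ht₀, hc₁', ?_⟩
  intro P hPd hPL hd2 k hk1 hkK hbig e he he1 hsm v hv Ω hΩ x μ f F D hF hsupp hdeep
  have hk : k ≤ P.m + P.K := hkK.trans (Nat.le_add_left _ _)
  have hdr : (P.d : ℝ) = (d : ℝ) + 1 := by rw [hPd]; push_cast; ring
  rw [← hdr] at hsm
  obtain ⟨hθ0, -, hplaq, h1, hT, h2, -⟩ := HK P hPd hPL hd2 k hk1 hk e he he1 hsm v hv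
  exact H P hPd hPL k hk1 hkK hbig (actualBgU1 hd2 k e v) _ hθ0 hplaq h1 _ hT h2 Ω hΩ x μ f F D hF hsupp hdeep

/-- **[7] (1.10), VALUE MEMBER, KERNEL FORM, FOR `G_k(Ω,u_k)` ON EVERY `k`-BLOCK UNION AT THE ACTUAL BACKGROUND UNDER THE PRINTED (7.3.1)**,
every dimension `D = d ≥ 2`, every `L`: `c₁ = 1/(23D²K(D, L)) > 0` and `t₀, c₀ > 0` (from `(d, a)` only) with
`‖G_k(Ω,u_k; x, y)‖ ≤ c₀(L^kε)²e^{−t₀|x−y|_∞/L^k}` for every torus (`P.d = d`, `P.L = L`), `1 ≤ k ≤ m + K` with `2(L^k−1)+4 < |T|`, `0 < e ≤ 1`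
with `e𝓅(e) ≤ c₁`, every `v` with (7.3.1), every `k`-block union `Ω` and all `x, y` — p34 gen 16 v1.2's `decay_kernel_smallPlaquette_region_uniform`
at `θ = K·e𝓅(e)/(L^k)²`.
[cite: BalabanImbrieJaffe1985, (7.3.1) p.326 «also satisfy the regularity and decay estimates of [7]»]
[cite: Balaban1983RegularityDecay, Theorem p.573 (1.10)] [cite: BalabanImbrieJaffe1988, (2.30) p.263] -/
theorem decay_kernel_region_actualBg (d L : ℕ) (hd : 2 ≤ d) {a : ℝ} (ha : 0 < a) (pexp : ℝ) :
    ∃ c₁ t₀ c₀ : ℝ, 0 < c₁ ∧ 0 < t₀ ∧ 0 < c₀ ∧ ∀ (P : Params) (hPd : P.d = d), P.L = L →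
      ∀ (hd2 : 2 ≤ P.d) (k : ℕ), 1 ≤ k → k ≤ P.m + P.K → 2 * (P.L ^ k - 1) + 4 < P.sitesPerDir 0 →
      ∀ (e : ℝ), 0 < e → e ≤ 1 → e * (1 + Real.log e⁻¹) ^ pexp ≤ c₁ →
      ∀ (v : U1Field P k), (∀ q : TPlaq P k, ‖((plaq v q : Circle) : ℂ) - 1‖ ≤ e * (1 + Real.log e⁻¹) ^ pexp) →
        ∀ Ω : Finset (TSite P 0), IsBlockUnion k Ω →
          ∀ x y : TSite P 0,
            ‖gBox (B1RG242Torus.α P a k * (P.L : ℝ) ^ (k * P.d)) P.eps⁻¹ (actualBgU1 hd2 k e v) k Ω x y‖ ≤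
              c₀ * P.spacing k ^ 2 * Real.exp (-(t₀ * (supDist x y : ℝ) / (P.L : ℝ) ^ k)) := by
  obtain ⟨K, hK1, HK⟩ := smallPlaquette_actualBg (d := d) (L := L) hd pexp
  obtain ⟨t₀, c₀, ht₀, hc₀, H⟩ := decay_kernel_smallPlaquette_region_uniform d ha
  refine ⟨1 / (23 * (d : ℝ) ^ 2 * K), t₀, c₀, by positivity, ht₀, hc₀, ?_⟩
  intro P hPd hPL hd2 k hk1 hk hbig e he he1 hsm v hv Ω hΩ x y
  have hdr : (P.d : ℝ) = (d : ℝ) := by rw [hPd]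
  rw [← hdr] at hsm
  obtain ⟨hθ0, -, hplaq, -, hT, h2, -⟩ := HK P hPd hPL hd2 k hk1 hk e he he1 hsm v hv
  exact H P hPd k hk1 hk hbig (actualBgU1 hd2 k e v) _ hθ0 hplaq _ hT h2 Ω hΩ x y

/-- **[7] (1.10), COVARIANT-DERIVATIVE MEMBER, KERNEL FORM, FOR `G_k(Ω,u_k)` ON EVERY `k`-BLOCK UNION AT THE ACTUAL BACKGROUND UNDER THE
PRINTED (7.3.1)**, every dimension `D = d ≥ 2`, every `L`: `c₁ = 1/(23D²K(D, L)) > 0` and `t₀, c₁′ > 0` (from `(d, a)` only) with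
`‖ε⁻¹(u_k(b)G_k(Ω,u_k; b₊, y) − G_k(Ω,u_k; b₋, y))‖ ≤ c₁′(L^kε)e^{−t₀|y−b₊|_∞/L^k}` for every bond `b ∈ Ω*` and every `y`, under the same data —
p34 gen 16 v1.2's `decay_covD_kernel_smallPlaquette_region_uniform` at `θ = K·e𝓅(e)/(L^k)²`.
[cite: BalabanImbrieJaffe1985, (7.3.1) p.326 «also satisfy the regularity and decay estimates of [7]»]
[cite: Balaban1983RegularityDecay, Theorem p.573 (1.10)] [cite: BalabanImbrieJaffe1988, p.263 «Bounds analogous to (2.30), (2.31) hold for covariant derivatives»] -/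
theorem decay_covD_kernel_region_actualBg (d L : ℕ) (hd : 2 ≤ d) {a : ℝ} (ha : 0 < a) (pexp : ℝ) :
    ∃ c₁ t₀ c₁' : ℝ, 0 < c₁ ∧ 0 < t₀ ∧ 0 < c₁' ∧ ∀ (P : Params) (hPd : P.d = d), P.L = L →
      ∀ (hd2 : 2 ≤ P.d) (k : ℕ), 1 ≤ k → k ≤ P.m + P.K → 2 * (P.L ^ k - 1) + 4 < P.sitesPerDir 0 →
      ∀ (e : ℝ), 0 < e → e ≤ 1 → e * (1 + Real.log e⁻¹) ^ pexp ≤ c₁ →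
      ∀ (v : U1Field P k), (∀ q : TPlaq P k, ‖((plaq v q : Circle) : ℂ) - 1‖ ≤ e * (1 + Real.log e⁻¹) ^ pexp) →
        ∀ Ω : Finset (TSite P 0), IsBlockUnion k Ω →
          ∀ b ∈ starB Ω, ∀ y : TSite P 0,
            ‖covD P.eps⁻¹ (cfg (actualBgU1 hd2 k e v))
                (fun x => gBox (B1RG242Torus.α P a k * (P.L : ℝ) ^ (k * P.d)) P.eps⁻¹ (actualBgU1 hd2 k e v) k Ω x y) b‖ ≤
              c₁' * P.spacing k * Real.exp (-(t₀ * (supDist y b.tgt : ℝ) / (P.L : ℝ) ^ k)) := by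
  obtain ⟨K, hK1, HK⟩ := smallPlaquette_actualBg (d := d) (L := L) hd pexp
  obtain ⟨t₀, c₁', ht₀, hc₁', H⟩ := decay_covD_kernel_smallPlaquette_region_uniform d ha
  refine ⟨1 / (23 * (d : ℝ) ^ 2 * K), t₀, c₁', by positivity, ht₀, hc₁', ?_⟩
  intro P hPd hPL hd2 k hk1 hk hbig e he he1 hsm v hv Ω hΩ b hb y
  have hdr : (P.d : ℝ) = (d : ℝ) := by rw [hPd]
  rw [← hdr] at hsm
  obtain ⟨hθ0, -, hplaq, -, hT, h2, -⟩ := HK P hPd hPL hd2 k hk1 hk e he he1 hsm v hv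
  exact H P hPd k hk1 hk hbig (actualBgU1 hd2 k e v) _ hθ0 hplaq _ hT h2 Ω hΩ b hb y

end Members

end

end Literature.MathematicalPhysics.QuantumFieldTheory.BalabanImbrieJaffe1984to88.BIJ88NeumannPropagatorActualBackground
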